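import Literature.AnabelianGeometry.SemiGraphs.TemperedConj2OfLocallyFinite
import Literature.AnabelianGeometry.SemiGraphs.TemperedCompactFixedSystemsBaire
import Literature.AnabelianGeometry.SemiGraphs.TemperedMaximalCompact
import HarnessLib

/-!
# [SemiAnbd] Thm 3.7 (iii), FIRST sentence for ANCHORED compact subgroups at locally finite `𝒢`

Mochizuki, *Semi-graphs of anabelioids*, Publ. RIMS **42** (2006), §3, Theorem 3.7 (iii) pp. 40–41
[cite: MochizukiSemiAnbd2006, Thm 3.7(iii) pp.40-41]: "any compact subgroup of `π₁^temp(𝒢)` is contained in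
at least one verticial subgroup"; (iv) p. 41: "the maximal compact subgroups of `π₁^temp(𝒢)` are precisely the
verticial subgroups".

PROOF-ONLY (cell abc-iut, layer L3, GAP row G-t6g3-2 / sub-row «anchored» of abc-iut-L3-d1's synthesis
2026-08-26; seat abc-iut-w6-d062, HBDD-LOCFIN programme, memo HOME/staging/w6/w6-d062/HBDD-LOCFIN-memo.md;
no definition).  The EXISTENCE sentence of Thm 3.7 (iii) fails at the countermodel `𝒢_θ` (abc-iut-L3-d1) for
ANCHOR-FREE compact subgroups (Chabauty-type limits meeting every verticial subgroup trivially).  Here it is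
PROVED, at every countable LOCALLY FINITE `𝒢` satisfying the hypotheses of Thm 3.7 and in every chart, for
compact subgroups `K` that are ANCHORED — `K ⊓ H₀ ≠ 1` for some verticial subgroup `H₀`:

* `VerticialLevelData.exists_level_forall_fixed_dist_le_four` — CONFINEMENT over abstract level data: under
  the local level-estrangement hypothesis (LE_C,w) of `TemperedHbddOfLocalLevelEstrangement.lean` for a
  subgroup `C` fixing a compatible vertex system `x`, for every level `j` there is ONE level `k ≥ j` such that
  EVERY `C`-fixed vertex of `𝒢_{∞,k}` projects within subdivision distance `4` of `x_j` (two-stage folding: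
  a first level pins the level-`j` image edge of all `C`-fixed edges at `x_k`, a second one folds along the
  `C`-fixed geodesics, whose vertices then lie over the two ends of that edge);
* `VerticialLevelData.displacement_le_eight_of_anchored` — a compact `K ⊇ C` moves each `x_j` by at most `8`:
  at the level `k`, `K` fixes some tree vertex `z` (Lemma 1.8 (ii) form
  `SemiGraph.exists_fixed_vertex_of_isCompact_over`), which is `C`-fixed, so `x_j` and `g • x_j` (`g ∈ K`,
  `g • z = z`, transitions equivariant, automorphisms isometric) are both within `4` of the image of `z`;
* `VerticialLevelData.exists_verticial_ge_of_anchored` — hence (abc-iut-w5-d189/abc-iut-L3-t10's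
  `exists_fixedSystem_of_displacement_le`, then (I2) `stab`) `K` lies in a verticial subgroup;
* `exists_verticial_ge_of_inf_verticial_ne_bot_of_isLocallyFinite` — at the canonical tower ((LE) =
  `localLevelEstranged_temperedPiChart`, `TemperedHbddOfLocallyFinite.lean`; (I1) `fix` for the anchor)
  transported to EVERY chart (`TemperedPiChart.exists_compatIso`, `VerticialLevelData.transport`):
  **every anchored compact subgroup of `π₁^temp(𝒢)` lies in a verticial subgroup**, `𝒢` locally finite;
* `exists_mem_verticialSubgroups_of_isMaximalCompactSubgroup_of_isLocallyFinite` — Thm 3.7 (iv), first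
  clause, for ANCHORED maximal compact subgroups: they are verticial (verticial subgroups being compact);
* `le_verticial_or_anchorFree_of_isLocallyFinite`, `exists_anchorFree_of_not_compactInVerticialAt_of_isLocallyFinite`
  — the dichotomy «in a verticial subgroup, or anchor-free» and the negative reading of `¬ CompactInVerticialAt 𝒢`;
* `exists_verticial_ge_of_forall_mem_of_isLocallyFinite`, `compactInVerticialAt_iff_forall_mem_exists_verticial_of_isLocallyFinite`
  — ELEMENTWISE REDUCTION: a compact subgroup covered by verticial subgroups lies in one; at locally finite `𝔾`,
  Thm 3.7 (iii) at `𝒢` ⇔ every element of every compact subgroup lies in some verticial subgroup.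

So at a locally finite `𝔾` the only possible violators of the existence sentence are anchor-free.  Nothing here
asserts the existence sentence for all compact subgroups; nothing bears on [IUTchIII] Cor. 3.12; typed ≠ proved.
-/

namespace Literature.AnabelianGeometry.SemiGraphs

namespace ProfiniteSemiGraph

namespace VerticialLevelData

open CategoryTheory Topology

universe v u

variable {𝒢 : ProfiniteSemiGraph.{u}} {c : TemperedPiChart 𝒢} (D : VerticialLevelData.{v} 𝒢 c)

/-- The first step of a subdivision walk from the point of a vertex to the point of another vertex is a
branch at the origin. [cite: MochizukiSemiAnbd2006, §1 pp.11-12] -/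
private theorem exists_first_branch {T : SemiGraph.{u}} {y y' : T.Vertex} (hne : y ≠ y')
    (p : T.subdivision.Walk (Sum.inl y) (Sum.inl y')) :
    ∃ β : T.Branch, T.abuts β = some y ∧ (Sum.inr (Sum.inr β) : T.Node) ∈ p.support := by
  cases p with
  | nil => exact (hne rfl).elim
  | cons h q =>
    obtain ⟨β, hβ, hq⟩ := (T.subdivision_adj_inl_iff y _).1 h
    subst hq
    exact ⟨β, hβ, by simp⟩

/-- Base vertices along the transition maps. [cite: MochizukiSemiAnbd2006, Thm 3.7(iii) p.41] -/
private theorem proj_eq_proj_trans ⦃j k : D.J⦄ (h : j ≤ k) (v : (D.tree k).Vertex) :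
    (D.proj k).vertexMap v = (D.proj j).vertexMap ((D.trans h).vertexMap v) := by
  have e := congrArg (fun φ => SemiGraph.Hom.vertexMap φ v) (D.trans_over h)
  simpa only [SemiGraph.comp_vertexMap, Function.comp_apply] using e.symm

/-- **CONFINEMENT of the fixed locus from local level-estrangement** ([SemiAnbd] Thm 3.7 (iii) p. 41, the
sub-joint folding step, localised): if (LE_C,w) holds at every base vertex for a subgroup `C` fixing the
compatible vertex system `x`, then for every level `j` there is a level `k ≥ j` such that EVERY `C`-fixed
vertex `z` of `𝒢_{∞,k}` maps into `𝒢_{∞,j}` within subdivision distance `4` of `x_j` (i.e. onto `x_j` or onto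
the far end of one edge at `x_j`).  Two-stage folding: the (LE)-level `k₁` at the base vertex `u` of `x` pins
the level-`j` image `ε*` of every `C`-fixed edge at `x_k` (`k ≥ k₁`); at `k ≥ k₁` and beyond the (LE)-level
at the base vertex `w*` under the far end of `ε*`, the `C`-fixed geodesic `x_k → z` folds into `ε*`
(`SemiGraph.vertexMap_eq_or_eq_of_folding`). [cite: MochizukiSemiAnbd2006, Thm 3.7(iii) p.41] -/
theorem exists_level_forall_fixed_dist_le_four (C : Subgroup c.G)
    (hLE : ∀ (w : 𝒢.graph.Vertex) (j : D.J), ∃ (k : D.J) (hjk : j ≤ k), ∀ (k' : D.J) (hkk' : k ≤ k')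
      (v : (D.tree k').Vertex), (D.proj k').vertexMap v = w →
      ∀ (b b' : (D.tree k').Branch), (D.tree k').abuts b = some v → (D.tree k').abuts b' = some v →
      (D.tree k').edgeOf b ≠ (D.tree k').edgeOf b' →
      (∀ g ∈ C, (D.act k' g).hom.edgeMap ((D.tree k').edgeOf b) = (D.tree k').edgeOf b) →
      (∀ g ∈ C, (D.act k' g).hom.edgeMap ((D.tree k').edgeOf b') = (D.tree k').edgeOf b') →
      (D.trans (hjk.trans hkk')).edgeMap ((D.tree k').edgeOf b) =
        (D.trans (hjk.trans hkk')).edgeMap ((D.tree k').edgeOf b'))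
    (x : ∀ j, (D.tree j).Vertex)
    (hx : ∀ ⦃i j : D.J⦄ (h : i ≤ j), (D.trans h).vertexMap (x j) = x i)
    (hfx : ∀ g ∈ C, ∀ j, (D.act j g).hom.vertexMap (x j) = x j) (j : D.J) :
    ∃ (k : D.J) (hjk : j ≤ k), ∀ z : (D.tree k).Vertex, (∀ g ∈ C, (D.act k g).hom.vertexMap z = z) →
      (D.tree j).subdivision.dist (Sum.inl (x j)) (Sum.inl ((D.trans hjk).vertexMap z)) ≤ 4 := by
  classical
  -- the `C`-fixed points of the subdivision of a level, and the `C`-fixed geodesic from `x k` to a fixed `z`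
  let F : ∀ k : D.J, Set (D.tree k).Node := fun k => {z | ∀ g ∈ C, SemiGraph.nodeMap (D.act k g) z = z}
  have hpath : ∀ (k : D.J) (z : (D.tree k).Vertex), (∀ g ∈ C, (D.act k g).hom.vertexMap z = z) →
      ∃ p : (D.tree k).subdivision.Walk (Sum.inl (x k)) (Sum.inl z), ∀ n ∈ p.support, n ∈ F k := by
    intro k z hz
    have hT := (D.isTree k).isTree
    let p : (D.tree k).subdivision.Path (Sum.inl (x k)) (Sum.inl z) :=
      (hT.connected (Sum.inl (x k)) (Sum.inl z)).some.toPath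
    refine ⟨p.1, fun n hn g hg => ?_⟩
    have hxn : SemiGraph.nodeMap (D.act k g) (Sum.inl (x k)) = Sum.inl (x k) := by simp [hfx g hg k]
    have hzn : SemiGraph.nodeMap (D.act k g) (Sum.inl z) = Sum.inl z := by simp [hz g hg]
    exact SemiGraph.nodeMap_eq_self_of_isPath hT.isAcyclic _ hxn hzn p.1 p.2 n hn
  -- fixed branch-points have fixed edges
  have hFedge : ∀ (k : D.J) (β : (D.tree k).Branch), (Sum.inr (Sum.inr β) : (D.tree k).Node) ∈ F k →
      ∀ g ∈ C, (D.act k g).hom.edgeMap ((D.tree k).edgeOf β) = (D.tree k).edgeOf β := by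
    intro k β hβ g hg
    have h := hβ g hg
    simp only [SemiGraph.nodeMap_inr_inr, Sum.inr.injEq] at h
    rw [← (D.act k g).hom.edgeOf_branchMap β, h]
  -- the base vertex under `x`
  set u : 𝒢.graph.Vertex := (D.proj j).vertexMap (x j) with hu
  have hxu : ∀ (k : D.J) (h : j ≤ k), (D.proj k).vertexMap (x k) = u := fun k h => by
    rw [D.proj_eq_proj_trans h, hx h]
  -- STAGE 1: level `k₁` from (LE) at `u`
  obtain ⟨k₁, hjk₁, h₁⟩ := hLE u j
  by_cases hex : ∃ z₁ : (D.tree k₁).Vertex, (∀ g ∈ C, (D.act k₁ g).hom.vertexMap z₁ = z₁) ∧ z₁ ≠ x k₁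
  swap
  · -- no `C`-fixed vertex of level `k₁` other than `x k₁`: every fixed vertex above maps onto `x j`
    refine ⟨k₁, hjk₁, fun z hz => ?_⟩
    have hzx : z = x k₁ := by
      by_contra hne
      exact hex ⟨z, hz, hne⟩
    rw [hzx, hx hjk₁, SimpleGraph.dist_self]
    exact Nat.zero_le _
  -- a fixed `z₁ ≠ x k₁`: its first branch `β₁` pins the image edge `ε*` at level `j`, far end `a'` over `w*`
  obtain ⟨z₁, hz₁, hne₁⟩ := hex
  obtain ⟨p₁, hp₁⟩ := hpath k₁ z₁ hz₁
  obtain ⟨β₁, hβ₁, hβ₁F⟩ := exists_first_branch (fun h => hne₁ h.symm) p₁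
  set ε : (D.tree j).Edge := (D.trans hjk₁).edgeMap ((D.tree k₁).edgeOf β₁) with hε
  have hc₀ε : (D.tree j).edgeOf ((D.trans hjk₁).branchMap β₁) = ε := (D.trans hjk₁).edgeOf_branchMap β₁
  have hc₀a : (D.tree j).abuts ((D.trans hjk₁).branchMap β₁) = some (x j) := by
    rw [(D.trans hjk₁).abuts_branchMap β₁ _ hβ₁, hx hjk₁]
  obtain ⟨a', hends, hdist⟩ := SemiGraph.exists_ends_dist_le_four ε _ hc₀ε hc₀a
  set w : 𝒢.graph.Vertex := (D.proj j).vertexMap a' with hw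
  -- STAGE 2: level `k'` beyond `k₁` and beyond the (LE)-level at `w*`
  obtain ⟨k₂, hjk₂, h₂⟩ := hLE w j
  obtain ⟨k', hk₁k', hk₂k'⟩ := exists_ge_ge k₁ k₂
  have hjk' : j ≤ k' := hjk₁.trans hk₁k'
  refine ⟨k', hjk', fun z hz => ?_⟩
  by_cases hzx : z = x k'
  · rw [hzx, hx hjk', SimpleGraph.dist_self]
    exact Nat.zero_le _
  obtain ⟨p', hp'⟩ := hpath k' z hz
  obtain ⟨β', hβ', hβ'F⟩ := exists_first_branch (fun h => hzx h.symm) p'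
  -- the first fixed branch at level `k'` maps to `ε*` (by (LE) at `u`, level `k₁`)
  have hβ'ε : (D.trans hjk').edgeMap ((D.tree k').edgeOf β') = ε := by
    have himg : (D.trans hjk').edgeMap ((D.tree k').edgeOf β') =
        (D.trans hjk₁).edgeMap ((D.tree k₁).edgeOf ((D.trans hk₁k').branchMap β')) := by
      rw [(D.trans hk₁k').edgeOf_branchMap,
        show D.trans hjk' = D.trans hk₁k' ≫ D.trans hjk₁ from (D.trans_comp hjk₁ hk₁k').symm,
        SemiGraph.comp_edgeMap, Function.comp_apply]
    rw [himg, hε]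
    by_cases hee : (D.tree k₁).edgeOf ((D.trans hk₁k').branchMap β') = (D.tree k₁).edgeOf β₁
    · rw [hee]
    · have habut : (D.tree k₁).abuts ((D.trans hk₁k').branchMap β') = some (x k₁) := by
        rw [(D.trans hk₁k').abuts_branchMap β' _ hβ', hx hk₁k']
      have hfix' : ∀ g ∈ C, (D.act k₁ g).hom.edgeMap ((D.tree k₁).edgeOf ((D.trans hk₁k').branchMap β')) =
          (D.tree k₁).edgeOf ((D.trans hk₁k').branchMap β') := by
        intro g hg
        rw [(D.trans hk₁k').edgeOf_branchMap, ← D.trans_act_edgeMap hk₁k' g, hFedge k' β' (hp' _ hβ'F) g hg]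
      have key := h₁ k₁ le_rfl (x k₁) (hxu k₁ hjk₁) _ _ habut hβ₁ hee hfix' (hFedge k₁ β₁ (hp₁ _ hβ₁F))
      simpa using key
  -- FOLD at level `k'` along the transition to level `j`
  have hfold := SemiGraph.vertexMap_eq_or_eq_of_folding (D.trans hjk') (F k') hends ?_ p' hp'
    (Or.inl (hx hjk')) β' (hp' _ hβ'F) hβ' hβ'ε
  · rcases hfold with h | h
    · rw [h, SimpleGraph.dist_self]
      exact Nat.zero_le _
    · rw [h]
      exact hdist
  · -- the folding hypothesis at tree vertices mapping to `x j` (over `u`) or to `a'` (over `w*`)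
    intro v _ hv β β'' hβF hβ''F hβv hβ''v
    by_cases hee : (D.tree k').edgeOf β = (D.tree k').edgeOf β''
    · rw [hee]
    rcases hv with hv | hv
    · have hvu : (D.proj k').vertexMap v = u := by rw [D.proj_eq_proj_trans hjk', hv]
      have key := h₁ k' hk₁k' v hvu β β'' hβv hβ''v hee (hFedge k' β hβF) (hFedge k' β'' hβ''F)
      simpa using key
    · have hvw : (D.proj k').vertexMap v = w := by rw [D.proj_eq_proj_trans hjk', hv]
      have key := h₂ k' hk₂k' v hvw β β'' hβv hβ''v hee (hFedge k' β hβF) (hFedge k' β'' hβ''F)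
      simpa using key

/-- **Uniform displacement `≤ 8` of an ANCHORED compact subgroup** ([SemiAnbd] Thm 3.7 (iii) p. 41): if `C`
satisfies (LE_C,w) everywhere and fixes the compatible system `x`, then every compact `K ⊇ C` moves each `x_j`
by at most `8` in the subdivision of `𝒢_{∞,j}` — at the confinement level `k`, `K` fixes some tree vertex `z`
(`SemiGraph.exists_fixed_vertex_of_isCompact_over`), whose image lies within `4` of `x_j` and, for `g ∈ K`,
within `4` of `g • x_j` (equivariance of the transitions, isometry of `g`).
[cite: MochizukiSemiAnbd2006, Thm 3.7(iii) p.41] -/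
theorem displacement_le_eight_of_anchored (C : Subgroup c.G)
    (hLE : ∀ (w : 𝒢.graph.Vertex) (j : D.J), ∃ (k : D.J) (hjk : j ≤ k), ∀ (k' : D.J) (hkk' : k ≤ k')
      (v : (D.tree k').Vertex), (D.proj k').vertexMap v = w →
      ∀ (b b' : (D.tree k').Branch), (D.tree k').abuts b = some v → (D.tree k').abuts b' = some v →
      (D.tree k').edgeOf b ≠ (D.tree k').edgeOf b' →
      (∀ g ∈ C, (D.act k' g).hom.edgeMap ((D.tree k').edgeOf b) = (D.tree k').edgeOf b) →
      (∀ g ∈ C, (D.act k' g).hom.edgeMap ((D.tree k').edgeOf b') = (D.tree k').edgeOf b') →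
      (D.trans (hjk.trans hkk')).edgeMap ((D.tree k').edgeOf b) =
        (D.trans (hjk.trans hkk')).edgeMap ((D.tree k').edgeOf b'))
    (x : ∀ j, (D.tree j).Vertex)
    (hx : ∀ ⦃i j : D.J⦄ (h : i ≤ j), (D.trans h).vertexMap (x j) = x i)
    (hfx : ∀ g ∈ C, ∀ j, (D.act j g).hom.vertexMap (x j) = x j)
    (K : Subgroup c.G) (hK : IsCompact (K : Set c.G)) (hCK : C ≤ K) :
    ∀ g ∈ K, ∀ j, (D.tree j).subdivision.dist (Sum.inl (x j))
      (Sum.inl ((D.act j g).hom.vertexMap (x j))) ≤ 8 := by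
  intro g hg j
  obtain ⟨k, hjk, hk⟩ := D.exists_level_forall_fixed_dist_le_four C hLE x hx hfx j
  obtain ⟨z, hz⟩ := SemiGraph.exists_fixed_vertex_of_isCompact_over K hK (D.isTree k) (D.vertex k)
    (D.proj k) (D.act k) (D.isOpen_ker k) (D.act_over k)
  have h4 : (D.tree j).subdivision.dist (Sum.inl (x j)) (Sum.inl ((D.trans hjk).vertexMap z)) ≤ 4 :=
    hk z fun g' hg' => hz ⟨g', hCK hg'⟩
  -- `g` fixes the image of `z`
  have hgz : (D.act j g).hom.vertexMap ((D.trans hjk).vertexMap z) = (D.trans hjk).vertexMap z := by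
    rw [← D.trans_act_vertexMap hjk g z, hz ⟨g, hg⟩]
  -- `g` is an isometry of the subdivision
  have hconn : (D.tree j).IsConnected := ⟨(D.isTree j).isTree.1⟩
  have hiso := SemiGraph.subdivision_dist_nodeMap hconn (D.act j g)
    (Sum.inl ((D.trans hjk).vertexMap z)) (Sum.inl (x j))
  simp only [SemiGraph.nodeMap_inl, hgz] at hiso
  have htri := (D.isTree j).isTree.1.dist_triangle (u := (Sum.inl (x j) : (D.tree j).Node))
    (v := Sum.inl ((D.trans hjk).vertexMap z)) (w := Sum.inl ((D.act j g).hom.vertexMap (x j)))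
  rw [hiso] at htri
  have hsymm : (D.tree j).subdivision.dist (Sum.inl ((D.trans hjk).vertexMap z)) (Sum.inl (x j)) =
      (D.tree j).subdivision.dist (Sum.inl (x j)) (Sum.inl ((D.trans hjk).vertexMap z)) :=
    SimpleGraph.dist_comm
  omega

/-- **An ANCHORED compact subgroup lies in a verticial subgroup** (over abstract level data): under (LE_C,w)
everywhere for a subgroup `C` fixing a compatible vertex system, every compact `K ⊇ C` is contained in a
verticial subgroup — uniform displacement `≤ 8` (`displacement_le_eight_of_anchored`), a `K`-fixed compatible
system (`exists_fixedSystem_of_displacement_le`), and (I2). [cite: MochizukiSemiAnbd2006, Thm 3.7(iii) pp.40-41] -/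
theorem exists_verticial_ge_of_anchored (C : Subgroup c.G)
    (hLE : ∀ (w : 𝒢.graph.Vertex) (j : D.J), ∃ (k : D.J) (hjk : j ≤ k), ∀ (k' : D.J) (hkk' : k ≤ k')
      (v : (D.tree k').Vertex), (D.proj k').vertexMap v = w →
      ∀ (b b' : (D.tree k').Branch), (D.tree k').abuts b = some v → (D.tree k').abuts b' = some v →
      (D.tree k').edgeOf b ≠ (D.tree k').edgeOf b' →
      (∀ g ∈ C, (D.act k' g).hom.edgeMap ((D.tree k').edgeOf b) = (D.tree k').edgeOf b) →
      (∀ g ∈ C, (D.act k' g).hom.edgeMap ((D.tree k').edgeOf b') = (D.tree k').edgeOf b') →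
      (D.trans (hjk.trans hkk')).edgeMap ((D.tree k').edgeOf b) =
        (D.trans (hjk.trans hkk')).edgeMap ((D.tree k').edgeOf b'))
    (x : ∀ j, (D.tree j).Vertex)
    (hx : ∀ ⦃i j : D.J⦄ (h : i ≤ j), (D.trans h).vertexMap (x j) = x i)
    (hfx : ∀ g ∈ C, ∀ j, (D.act j g).hom.vertexMap (x j) = x j)
    (K : Subgroup c.G) (hK : IsCompact (K : Set c.G)) (hCK : C ≤ K) :
    ∃ (v : 𝒢.graph.Vertex) (H : Subgroup c.G), H ∈ verticialSubgroups c v ∧ K ≤ H := by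
  obtain ⟨y, hy, hfy⟩ := D.exists_fixedSystem_of_displacement_le K hK x hx 8
    (D.displacement_le_eight_of_anchored C hLE x hx hfx K hK hCK)
  obtain ⟨v, H, hH, hst⟩ := D.stab y hy
  exact ⟨v, H, hH, fun g hg => hst g fun j => hfy g hg j⟩

end VerticialLevelData

open CategoryTheory Topology

universe u

variable (𝒢 : ProfiniteSemiGraph.{u})

/-- **[SemiAnbd] Thm 3.7 (iii), first sentence, for ANCHORED compact subgroups at every locally finite
countable `𝒢` and every chart**: if `𝒢` satisfies the hypotheses of Thm 3.7 and `𝔾` is locally finite, then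
every compact `K ≤ π₁^temp(𝒢)` meeting some verticial subgroup `H₀` nontrivially (`K ⊓ H₀ ≠ 1`) is contained
in a verticial subgroup.  ((LE) for the anchor `K ⊓ H₀` at the canonical tower is
`localLevelEstranged_temperedPiChart`; (I1) `fix` for `H₀`; chart transport `exists_compatIso` /
`VerticialLevelData.transport`.) [cite: MochizukiSemiAnbd2006, Thm 3.7(iii) pp.40-41] -/
theorem exists_verticial_ge_of_inf_verticial_ne_bot_of_isLocallyFinite (h37 : 𝒢.Thm37Hypotheses)
    (hlf : 𝒢.graph.IsLocallyFinite) (c : TemperedPiChart 𝒢) (K : Subgroup c.G)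
    (hKc : IsCompact (K : Set c.G)) {v₀ : 𝒢.graph.Vertex} {H₀ : Subgroup c.G}
    (hH₀ : H₀ ∈ verticialSubgroups c v₀) (hanch : K ⊓ H₀ ≠ ⊥) :
    ∃ (v : 𝒢.graph.Vertex) (H : Subgroup c.G), H ∈ verticialSubgroups c v ∧ K ≤ H := by
  obtain ⟨φ, ψ, hψφ, hφψ, hφ, hψ⟩ :=
    TemperedPiChart.exists_compatIso (𝒢.temperedPiChart h37.toProp36Hypotheses) c
  let D₀ := verticialLevelData_temperedPiChart (h36 := h37.toProp36Hypotheses)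
  let D : VerticialLevelData.{0} 𝒢 c := D₀.transport φ ψ hψφ hφψ
    (fun v H => mem_verticialSubgroups_iff_map φ hφ ψ hφψ hψ H)
    (fun e L => mem_edgeLikeSubgroups_iff_map φ hφ ψ hφψ hψ L)
  -- the anchor `K ⊓ H₀` fixes the (I1)-system of `H₀`
  obtain ⟨x, hx, hfxH⟩ := D.fix v₀ H₀ hH₀
  have hfx : ∀ g ∈ K ⊓ H₀, ∀ j, (D.act j g).hom.vertexMap (x j) = x j :=
    fun g hg j => hfxH g (Subgroup.mem_inf.mp hg).2 j
  -- (LE) for the anchor at the transported data, from (LE) at the canonical tower for its image under `ψ`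
  have hinj : Function.Injective ψ := fun y₁ y₂ h => by rw [← hφψ y₁, ← hφψ y₂, h]
  have hne' : (K ⊓ H₀).map ψ.toMonoidHom ≠ ⊥ := fun h0 =>
    hanch ((Subgroup.map_eq_bot_iff_of_injective (K ⊓ H₀) hinj).mp h0)
  refine D.exists_verticial_ge_of_anchored (K ⊓ H₀) (fun w j => ?_) x hx hfx K hKc inf_le_left
  obtain ⟨k, hjk, hk⟩ :=
    𝒢.localLevelEstranged_temperedPiChart h37 hlf ((K ⊓ H₀).map ψ.toMonoidHom) hne' w j
  refine ⟨k, hjk, fun k' hkk' v hv b b' hb hb' hne hfb hfb' => hk k' hkk' v hv b b' hb hb' hne ?_ ?_⟩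
  · rintro _ ⟨g, hg, rfl⟩
    exact hfb g hg
  · rintro _ ⟨g, hg, rfl⟩
    exact hfb' g hg

/-- **The same with an explicit anchor**: a compact `K` containing a subgroup `A ≠ 1` that lies in a verticial
subgroup is contained in a verticial subgroup (`𝒢` locally finite, hypotheses of Thm 3.7, every chart).
[cite: MochizukiSemiAnbd2006, Thm 3.7(iii) pp.40-41] -/
theorem exists_verticial_ge_of_anchored_of_isLocallyFinite (h37 : 𝒢.Thm37Hypotheses)
    (hlf : 𝒢.graph.IsLocallyFinite) (c : TemperedPiChart 𝒢) (K : Subgroup c.G)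
    (hKc : IsCompact (K : Set c.G)) {A : Subgroup c.G} (hA : A ≠ ⊥) (hAK : A ≤ K)
    {v₀ : 𝒢.graph.Vertex} {H₀ : Subgroup c.G} (hH₀ : H₀ ∈ verticialSubgroups c v₀) (hAH₀ : A ≤ H₀) :
    ∃ (v : 𝒢.graph.Vertex) (H : Subgroup c.G), H ∈ verticialSubgroups c v ∧ K ≤ H :=
  𝒢.exists_verticial_ge_of_inf_verticial_ne_bot_of_isLocallyFinite h37 hlf c K hKc hH₀
    fun h0 => hA (le_bot_iff.mp (h0 ▸ le_inf hAK hAH₀))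

/-- **[SemiAnbd] Thm 3.7 (iv), first clause, for ANCHORED maximal compact subgroups** (`𝒢` locally finite,
hypotheses of Thm 3.7, every chart): a maximal compact subgroup meeting some verticial subgroup nontrivially
IS a verticial subgroup (it lies in one, which is compact — `isCompact_of_mem_verticialSubgroups`).
[cite: MochizukiSemiAnbd2006, Thm 3.7(iv) p.41] -/
theorem exists_mem_verticialSubgroups_of_isMaximalCompactSubgroup_of_isLocallyFinite
    (h37 : 𝒢.Thm37Hypotheses) (hlf : 𝒢.graph.IsLocallyFinite) (c : TemperedPiChart 𝒢) (K : Subgroup c.G)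
    (hK : IsMaximalCompactSubgroup K) {v₀ : 𝒢.graph.Vertex} {H₀ : Subgroup c.G}
    (hH₀ : H₀ ∈ verticialSubgroups c v₀) (hanch : K ⊓ H₀ ≠ ⊥) :
    ∃ v : 𝒢.graph.Vertex, K ∈ verticialSubgroups c v := by
  obtain ⟨v, H, hH, hKH⟩ :=
    𝒢.exists_verticial_ge_of_inf_verticial_ne_bot_of_isLocallyFinite h37 hlf c K hK.1 hH₀ hanch
  exact ⟨v, (hK.2 H (isCompact_of_mem_verticialSubgroups c hH) hKH) ▸ hH⟩

/-- **The violators of the existence sentence are ANCHOR-FREE** (`𝒢` locally finite, hypotheses of Thm 3.7,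
every chart): a compact subgroup contained in no verticial subgroup meets every verticial subgroup trivially.
[cite: MochizukiSemiAnbd2006, Thm 3.7(iii) pp.40-41] -/
theorem inf_verticial_eq_bot_of_forall_not_le_of_isLocallyFinite (h37 : 𝒢.Thm37Hypotheses)
    (hlf : 𝒢.graph.IsLocallyFinite) (c : TemperedPiChart 𝒢) (K : Subgroup c.G)
    (hKc : IsCompact (K : Set c.G))
    (hnot : ∀ (v : 𝒢.graph.Vertex) (H : Subgroup c.G), H ∈ verticialSubgroups c v → ¬ K ≤ H)
    {v : 𝒢.graph.Vertex} {H : Subgroup c.G} (hH : H ∈ verticialSubgroups c v) : K ⊓ H = ⊥ := by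
  by_contra hne
  obtain ⟨v', H', hH', hKH'⟩ :=
    𝒢.exists_verticial_ge_of_inf_verticial_ne_bot_of_isLocallyFinite h37 hlf c K hKc hH hne
  exact hnot v' H' hH' hKH'

/-- **Dichotomy at a locally finite `𝒢`** (hypotheses of Thm 3.7, every chart): a compact subgroup of
`π₁^temp(𝒢)` is either contained in a verticial subgroup or ANCHOR-FREE (meets every verticial subgroup
trivially). [cite: MochizukiSemiAnbd2006, Thm 3.7(iii) pp.40-41] -/
theorem le_verticial_or_anchorFree_of_isLocallyFinite (h37 : 𝒢.Thm37Hypotheses)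
    (hlf : 𝒢.graph.IsLocallyFinite) (c : TemperedPiChart 𝒢) (K : Subgroup c.G)
    (hKc : IsCompact (K : Set c.G)) :
    (∃ (v : 𝒢.graph.Vertex) (H : Subgroup c.G), H ∈ verticialSubgroups c v ∧ K ≤ H) ∨
      ∀ (v : 𝒢.graph.Vertex) (H : Subgroup c.G), H ∈ verticialSubgroups c v → K ⊓ H = ⊥ := by
  by_cases h : ∃ (v : 𝒢.graph.Vertex) (H : Subgroup c.G), H ∈ verticialSubgroups c v ∧ K ≤ H
  · exact Or.inl h
  · exact Or.inr fun v H hH => 𝒢.inf_verticial_eq_bot_of_forall_not_le_of_isLocallyFinite h37 hlf c K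
      hKc (fun v' H' hH' hle => h ⟨v', H', hH', hle⟩) hH

/-- **Negative reading**: at a locally finite countable `𝒢`, if `CompactInVerticialAt 𝒢` fails then some chart
carries a NONTRIVIAL ANCHOR-FREE compact subgroup — compact, `≠ 1`, meeting every verticial subgroup trivially
(as the escaping subgroups of abc-iut-L3-d1's `𝒢_θ`). [cite: MochizukiSemiAnbd2006, Thm 3.7(iii) pp.40-41] -/
theorem exists_anchorFree_of_not_compactInVerticialAt_of_isLocallyFinite (hlf : 𝒢.graph.IsLocallyFinite)
    (hnot : ¬ CompactInVerticialAt 𝒢) :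
    ∃ (c : TemperedPiChart 𝒢) (K : Subgroup c.G), IsCompact (K : Set c.G) ∧ K ≠ ⊥ ∧
      ∀ (v : 𝒢.graph.Vertex) (H : Subgroup c.G), H ∈ verticialSubgroups c v → K ⊓ H = ⊥ := by
  by_cases h37 : 𝒢.Thm37Hypotheses
  swap
  · exact absurd (fun h => absurd h h37) hnot
  obtain ⟨c, K, hKc, hK⟩ := 𝒢.exists_compact_forall_not_le_verticial_of_isLocallyFinite hlf hnot
  refine ⟨c, K, hKc, ?_, fun v H hH =>
    𝒢.inf_verticial_eq_bot_of_forall_not_le_of_isLocallyFinite h37 hlf c K hKc hK hH⟩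
  obtain ⟨v⟩ := h37.hasVertex
  obtain ⟨H, hH⟩ := verticialSubgroups_nonempty h37.isQuasiCoherent h37.isGaloisCountable c v
  rintro rfl
  exact hK v H hH bot_le

/-- **ELEMENTWISE REDUCTION of the existence sentence at a locally finite `𝒢`** (hypotheses of Thm 3.7, every
chart): a compact subgroup each of whose elements lies in SOME verticial subgroup lies in ONE verticial
subgroup — a compact subgroup covered by the verticial subgroups is anchored at any of its nontrivial
elements. [cite: MochizukiSemiAnbd2006, Thm 3.7(iii) pp.40-41] -/
theorem exists_verticial_ge_of_forall_mem_of_isLocallyFinite (h37 : 𝒢.Thm37Hypotheses)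
    (hlf : 𝒢.graph.IsLocallyFinite) (c : TemperedPiChart 𝒢) (K : Subgroup c.G)
    (hKc : IsCompact (K : Set c.G))
    (hcov : ∀ g ∈ K, ∃ (v : 𝒢.graph.Vertex) (H : Subgroup c.G), H ∈ verticialSubgroups c v ∧ g ∈ H) :
    ∃ (v : 𝒢.graph.Vertex) (H : Subgroup c.G), H ∈ verticialSubgroups c v ∧ K ≤ H := by
  by_cases hK : K = ⊥
  · obtain ⟨v⟩ := h37.hasVertex
    obtain ⟨H, hH⟩ := verticialSubgroups_nonempty h37.isQuasiCoherent h37.isGaloisCountable c v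
    exact ⟨v, H, hH, hK ▸ bot_le⟩
  obtain ⟨⟨g, hgK⟩, hg1⟩ := Subgroup.ne_bot_iff_exists_ne_one.mp hK
  have hg1' : g ≠ 1 := fun h => hg1 (Subtype.ext h)
  obtain ⟨v₀, H₀, hH₀, hgH₀⟩ := hcov g hgK
  exact 𝒢.exists_verticial_ge_of_inf_verticial_ne_bot_of_isLocallyFinite h37 hlf c K hKc hH₀
    fun h0 => hg1' ((Subgroup.mem_bot).mp (h0 ▸ Subgroup.mem_inf.mpr ⟨hgK, hgH₀⟩))

/-- **At a locally finite countable `𝒢`, Thm 3.7 (iii) at `𝒢` is EQUIVALENT to its ELEMENTWISE existence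
sentence**: `CompactInVerticialAt 𝒢` holds iff (under the hypotheses of Thm 3.7) every ELEMENT of every compact
subgroup of every chart lies in some verticial subgroup.  (With `compactInVerticialAt_iff_exists_verticial_of_isLocallyFinite`:
the open core G-t6g3-2 at locally finite `𝔾` is a statement about single compact elements.)
[cite: MochizukiSemiAnbd2006, Thm 3.7(iii) pp.40-41] -/
theorem compactInVerticialAt_iff_forall_mem_exists_verticial_of_isLocallyFinite
    (hlf : 𝒢.graph.IsLocallyFinite) :
    CompactInVerticialAt 𝒢 ↔
      (𝒢.Thm37Hypotheses → ∀ (c : TemperedPiChart 𝒢) (K : Subgroup c.G), IsCompact (K : Set c.G) →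
        ∀ g ∈ K, ∃ (v : 𝒢.graph.Vertex) (H : Subgroup c.G), H ∈ verticialSubgroups c v ∧ g ∈ H) := by
  rw [𝒢.compactInVerticialAt_iff_exists_verticial_of_isLocallyFinite hlf]
  refine ⟨fun h h37 c K hKc g hg => ?_, fun h h37 c K hKc =>
    𝒢.exists_verticial_ge_of_forall_mem_of_isLocallyFinite h37 hlf c K hKc (h h37 c K hKc)⟩
  obtain ⟨v, H, hH, hKH⟩ := h h37 c K hKc
  exact ⟨v, H, hH, hKH hg⟩

end ProfiniteSemiGraph

end Literature.AnabelianGeometry.SemiGraphs
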